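import Summits.CriticalPhenomena.PercolationContinuityZ3.Theorems.Transplant.PlanarSkeletonFrmFromDefs
import Summits.CriticalPhenomena.PercolationContinuityZ3.Theorems.Transplant.SkelFrmFromBChoiceArrival
import Summits.CriticalPhenomena.PercolationContinuityZ3.Theorems.Transplant.SkelFrmBChoiceArrival
import HarnessLib
import Summits.CriticalPhenomena.PercolationContinuityZ3.Theorems.Transplant.SkelFrmBChoiceCreep
/-!
# U-WAVE PORT (RULING D-U, lead g21 2026-08-26; WAVE-U-MANIFEST v3.0 row «SkelFrmBChoiceCreep» ↦ «SkelFrmFromBChoiceCreep») of the tree module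
# `Transplant/SkelFrmBChoiceCreep` onto the carrier `PlanarSkeletonFrmFrom` (frames only, cylinders connected from width `ℓ₀` on)

ORIGINAL TITLE: N2 (frames-only node `SamePDropOfSkeletonFrm₁`, OPEN) — (ζ″) ledger under (R-40): THE CREEP VALUE OF RECORD `NegB.cRv / NegB.cR` AND THE (C) ARRIVAL-BOX

builds on p205010 (kernel theorem, internal audit signed; external expert review pending) — nothing in this file uses p205010; NOTHING is claimed about the
OPEN node U `SamePDropOfSkeletonFrmFrom₁` (nor U_s / the end state).  Lane `prim-bschramm`, seat `prim-hp-8 gen 53 (U-wave port pen, family P-hp8; tool of record = p3-g26 port_u.py)`; helper file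
(`--supports stmt-CriticalPhenomena-4575 --as helper`).  PORT RULES r1–r4 of RULING D-U: declaration order and proof texts are those of the original,
byte-identical except (i) the carrier token `PlanarSkeletonFrm ↦ PlanarSkeletonFrmFrom` (binders, `namespace`/`end` lines, qualified names of twinned
declarations), (ii) carrier-FREE declarations of the original (φ-level `Skelφ…` blocks and namespace-only arithmetic residents) are NOT re-declared —
this file imports the original and `export`s the twin-free residents (POLICY T / treatment (m1)); residents whose statement mentions a twinned
constant are copied, (iii) every carrier-binding declaration keeps its explicit binder `(Φ : PlanarSkeletonFrmFrom G)` in its own signature (r2).  Docstrings and citations are the original's.  Manifest row idx 107 (level 14; flags verbatim|DEF-ROW|RESIDENTS(T:0/free:2)|IDLE-FOR-NODE); filed by the hp-8 lineage under RULING M-11 (family P-hp8).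
-/

open scoped Classical

noncomputable section

namespace Summit.CriticalPhenomena.PercolationContinuityZ3.Theorems.Transplant

namespace PlanarSkeletonFrmFrom

namespace NegB

open Literature.Probability.Percolation Literature.Probability.LatticeModels SimpleGraph
open Literature.Probability.Percolation.KozmaNitzan.Cells (oth)
open SkelConc (Consts)
open Skelφ (shearUnit kgSL kgZ₁ kgM₁ kgM₂ kgWm₂ kgWp₂ kgE₁ kgA₁ kgX kgX₂ kgCtr2 kgHw2 kgDec₁ kgP kgT₁ kgFar rdLo rdHi KGRows)
open TwoAxis.Para (modulus)
open Neg

/-! ## §1 Two arithmetic helpers -/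

export PlanarSkeletonFrm.NegB (rd1_div_eq)

export PlanarSkeletonFrm.NegB (half_sum_eq)

/-! ## §2 The creep value of record and the across reading row -/

section Creep

variable (κ : Consts) {V : Type} [DecidableEq V] [Countable V] {G : SimpleGraph V} [G.LocallyFinite] (Φ : PlanarSkeletonFrmFrom G) (t : V) (p : unitInterval)
  (D : Skelφ.StepI.DataNS V) (g f mk : ℕ)

/-- **The midpoint of the arrival box's fine-1 reading** `⌊(rdLo₁ + rdHi₁)/2⌋` (an integer `≥ 0` under the floors). [this work] -/
def cmid (κ : Consts) {V : Type} [DecidableEq V] [Countable V] {G : SimpleGraph V} [G.LocallyFinite] (Φ : PlanarSkeletonFrmFrom G) (t : V) (p : unitInterval) (D : Skelφ.StepI.DataNS V) (g : ℕ) (f : ℕ) (mk : ℕ) : ℤ :=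
  (rdLo (Aof κ) (nL κ Φ t p D g f) (hL κ Φ t p D g f) (vL κ Φ t p D g f) (vβL κ Φ t p D g f) (prFA κ Φ t p D g f).c₀ (prFA κ Φ t p D g f).c₁
      (prFA κ Φ t p D g f).D (arrLoQ κ Φ t p D g f mk) (arrHiQ κ Φ t p D g f mk) 1 +
    rdHi (Aof κ) (nL κ Φ t p D g f) (hL κ Φ t p D g f) (vL κ Φ t p D g f) (vβL κ Φ t p D g f) (prFA κ Φ t p D g f).c₀ (prFA κ Φ t p D g f).c₁
      (prFA κ Φ t p D g f).D (arrLoQ κ Φ t p D g f mk) (arrHiQ κ Φ t p D g f mk) 1) / 2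

/-- **THE CREEP VALUE OF RECORD** (fine cells, per axis): `cRv 0 := cmid.toNat` (the x-step's creep, felt on coordinate 1), `cRv 1 := 0`. [this work] -/
def cRv (κ : Consts) {V : Type} [DecidableEq V] [Countable V] {G : SimpleGraph V} [G.LocallyFinite] (Φ : PlanarSkeletonFrmFrom G) (t : V) (p : unitInterval) (D : Skelφ.StepI.DataNS V) (g : ℕ) (f : ℕ) (mk : ℕ) : Fin 2 → ℕ := fun i => if i = 0 then (cmid κ Φ t p D g f mk).toNat else 0

/-- `cRv 1 = 0`. [folklore] -/
@[simp] theorem cRv_one (κ : Consts) {V : Type} [DecidableEq V] [Countable V] {G : SimpleGraph V} [G.LocallyFinite] (Φ : PlanarSkeletonFrmFrom G) (t : V) (p : unitInterval) (D : Skelφ.StepI.DataNS V) (g : ℕ) (f : ℕ) (mk : ℕ) : cRv κ Φ t p D g f mk 1 = 0 := by simp [cRv]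

/-- `cRv 0 = cmid.toNat`. [folklore] -/
theorem cRv_zero (κ : Consts) {V : Type} [DecidableEq V] [Countable V] {G : SimpleGraph V} [G.LocallyFinite] (Φ : PlanarSkeletonFrmFrom G) (t : V) (p : unitInterval) (D : Skelφ.StepI.DataNS V) (g : ℕ) (f : ℕ) (mk : ℕ) : cRv κ Φ t p D g f mk 0 = (cmid κ Φ t p D g f mk).toNat := by simp [cRv]

/-- **`lo₁ + hi₁ = Ctr2 ≥ 0`**, `hi₁ − lo₁ ≤ Hw2` and `lo₁ ≤ hi₁` for the arrival box's across rows (`Ctr2 = (m₁+1)(2R′ + dec₁)` by `kgE₁_spec`, `Hw2 ≥ 0`).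
[this work] -/
theorem arr1_sum_eq (κ : Consts) {V : Type} [DecidableEq V] [Countable V] {G : SimpleGraph V} [G.LocallyFinite] (Φ : PlanarSkeletonFrmFrom G) (t : V) (p : unitInterval) (D : Skelφ.StepI.DataNS V) (g : ℕ) (f : ℕ) (mk : ℕ) (hN : EqNumL κ Φ t p D g f) (hg : gFloorKG κ Φ t p D mk ≤ g) :
    arrLoQ κ Φ t p D g f mk 1 + arrHiQ κ Φ t p D g f mk 1 =
        kgCtr2 (nL κ Φ t p D g f) (ℓL κ Φ t p D g f) (hL κ Φ t p D g f) (kgR κ Φ t p D mk) 0 (kgW κ Φ t p D g f (WxQ κ Φ t p D g f))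
          (kgNv0 κ Φ t p D g f mk (qxQ κ Φ t p D g f) (WxQ κ Φ t p D g f)) ∧
      0 ≤ kgCtr2 (nL κ Φ t p D g f) (ℓL κ Φ t p D g f) (hL κ Φ t p D g f) (kgR κ Φ t p D mk) 0 (kgW κ Φ t p D g f (WxQ κ Φ t p D g f))
          (kgNv0 κ Φ t p D g f mk (qxQ κ Φ t p D g f) (WxQ κ Φ t p D g f)) ∧
      arrHiQ κ Φ t p D g f mk 1 - arrLoQ κ Φ t p D g f mk 1 ≤
        kgHw2 (nL κ Φ t p D g f) (ℓL κ Φ t p D g f) (hL κ Φ t p D g f) (vL κ Φ t p D g f) (kgR κ Φ t p D mk) 0 (kgq κ Φ t p D g f (qxQ κ Φ t p D g f))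
          (kgW κ Φ t p D g f (WxQ κ Φ t p D g f)) (kgNv0 κ Φ t p D g f mk (qxQ κ Φ t p D g f) (WxQ κ Φ t p D g f)) ∧
      arrLoQ κ Φ t p D g f mk 1 ≤ arrHiQ κ Φ t p D g f mk 1 := by
  have H := kgRows0_of κ Φ t p D g f mk (qxQ κ Φ t p D g f) (WxQ κ Φ t p D g f) hN hg
  set N := kgNv0 κ Φ t p D g f mk (qxQ κ Φ t p D g f) (WxQ κ Φ t p D g f) with hNdef
  obtain ⟨hE, -, -⟩ := H.kgE₁_spec N
  have hd := H.dec₁_pos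
  obtain ⟨-, h1⟩ := H.kgM₁_spec N
  have hm1 : (1 : ℤ) ≤ (((kgM₁ (nL κ Φ t p D g f) (ℓL κ Φ t p D g f) (hL κ Φ t p D g f) (kgR κ Φ t p D mk) 0 (kgW κ Φ t p D g f (WxQ κ Φ t p D g f)) N : ℕ) : ℤ)) + 1 := by
    have : (0 : ℤ) ≤ ((kgM₁ (nL κ Φ t p D g f) (ℓL κ Φ t p D g f) (hL κ Φ t p D g f) (kgR κ Φ t p D mk) 0 (kgW κ Φ t p D g f (WxQ κ Φ t p D g f)) N : ℕ) : ℤ) := by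
      positivity
    linarith
  have hR0 : (0 : ℤ) ≤ ((kgR κ Φ t p D mk : ℕ) : ℤ) := by positivity
  have e0 : arrLoQ κ Φ t p D g f mk 1 =
      (kgCtr2 (nL κ Φ t p D g f) (ℓL κ Φ t p D g f) (hL κ Φ t p D g f) (kgR κ Φ t p D mk) 0 (kgW κ Φ t p D g f (WxQ κ Φ t p D g f)) N -
        kgHw2 (nL κ Φ t p D g f) (ℓL κ Φ t p D g f) (hL κ Φ t p D g f) (vL κ Φ t p D g f) (kgR κ Φ t p D mk) 0 (kgq κ Φ t p D g f (qxQ κ Φ t p D g f))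
          (kgW κ Φ t p D g f (WxQ κ Φ t p D g f)) N + 1) / 2 := rfl
  have e1 : arrHiQ κ Φ t p D g f mk 1 =
      (kgCtr2 (nL κ Φ t p D g f) (ℓL κ Φ t p D g f) (hL κ Φ t p D g f) (kgR κ Φ t p D mk) 0 (kgW κ Φ t p D g f (WxQ κ Φ t p D g f)) N +
        kgHw2 (nL κ Φ t p D g f) (ℓL κ Φ t p D g f) (hL κ Φ t p D g f) (vL κ Φ t p D g f) (kgR κ Φ t p D mk) 0 (kgq κ Φ t p D g f (qxQ κ Φ t p D g f))
          (kgW κ Φ t p D g f (WxQ κ Φ t p D g f)) N) / 2 := rfl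
  set C := kgCtr2 (nL κ Φ t p D g f) (ℓL κ Φ t p D g f) (hL κ Φ t p D g f) (kgR κ Φ t p D mk) 0 (kgW κ Φ t p D g f (WxQ κ Φ t p D g f)) N with hC
  set Hw := kgHw2 (nL κ Φ t p D g f) (ℓL κ Φ t p D g f) (hL κ Φ t p D g f) (vL κ Φ t p D g f) (kgR κ Φ t p D mk) 0 (kgq κ Φ t p D g f (qxQ κ Φ t p D g f))
    (kgW κ Φ t p D g f (WxQ κ Φ t p D g f)) N with hHw
  obtain ⟨hs, hdiff, hle⟩ := half_sum_eq C Hw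
  obtain ⟨-, hE2, -⟩ := H.kgE₁_spec N
  have hHw1 : 1 ≤ Hw := by
    have hP0 : 1 ≤ kgP (nL κ Φ t p D g f) (ℓL κ Φ t p D g f) (hL κ Φ t p D g f) := by unfold kgP; exact Nat.le_add_left _ _
    have hP : (1 : ℤ) ≤ ((kgP (nL κ Φ t p D g f) (ℓL κ Φ t p D g f) (hL κ Φ t p D g f) : ℕ) : ℤ) := by exact_mod_cast hP0
    have h2 : (0 : ℤ) ≤ 2 * ((((kgM₂ (nL κ Φ t p D g f) (ℓL κ Φ t p D g f) (hL κ Φ t p D g f) (vL κ Φ t p D g f) (kgR κ Φ t p D mk) 0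
        (kgq κ Φ t p D g f (qxQ κ Φ t p D g f)) (kgW κ Φ t p D g f (WxQ κ Φ t p D g f)) N : ℕ) : ℤ) + 1) * (((kgR κ Φ t p D mk : ℕ) : ℤ) + ((0 : ℕ) : ℤ))) := by
      positivity
    rw [hHw]; unfold kgHw2; linarith
  refine ⟨by rw [e0, e1]; exact hs, ?_, by rw [e0, e1]; exact hdiff, by rw [e0, e1]; exact hle hHw1⟩
  -- `Ctr2 = 2(m₁+1)(R+ρ) + (m₁+1)·dec₁ ≥ 0`
  have eC : C = 2 * ((((kgM₁ (nL κ Φ t p D g f) (ℓL κ Φ t p D g f) (hL κ Φ t p D g f) (kgR κ Φ t p D mk) 0 (kgW κ Φ t p D g f (WxQ κ Φ t p D g f)) N : ℕ) : ℤ)) + 1) *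
      (((kgR κ Φ t p D mk : ℕ) : ℤ) + ((0 : ℕ) : ℤ)) +
      ((((kgM₁ (nL κ Φ t p D g f) (ℓL κ Φ t p D g f) (hL κ Φ t p D g f) (kgR κ Φ t p D mk) 0 (kgW κ Φ t p D g f (WxQ κ Φ t p D g f)) N : ℕ) : ℤ)) + 1) *
        kgDec₁ (nL κ Φ t p D g f) (ℓL κ Φ t p D g f) (hL κ Φ t p D g f) (kgR κ Φ t p D mk) 0 := by
    rw [hC]; unfold kgCtr2; rw [hE]; ring
  rw [eC]
  have hd0 : 0 ≤ kgDec₁ (nL κ Φ t p D g f) (ℓL κ Φ t p D g f) (hL κ Φ t p D g f) (kgR κ Φ t p D mk) 0 := by linarith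
  push_cast
  positivity

/-- **`Hw2 + 1 ≤ 4·sL`** at the tuple of record (`E₁ ≤ 2P + dec₁ − 1 ≤ 3sL + 3 − 2R′`, `2(m₂+1)R′ ≤ 426R′`, `1600R′ ≤ 40K·R′ ≤ sL + 1`). [this work] -/
theorem kgHw2Q_le (κ : Consts) {V : Type} [DecidableEq V] [Countable V] {G : SimpleGraph V} [G.LocallyFinite] (Φ : PlanarSkeletonFrmFrom G) (t : V) (p : unitInterval) (D : Skelφ.StepI.DataNS V) (g : ℕ) (f : ℕ) (mk : ℕ) (hN : EqNumL κ Φ t p D g f) (hg : gFloorKG κ Φ t p D mk ≤ g) (hg2 : 40 * Neg.K κ * KS0.R'0 κ Φ t p D mk ≤ g) :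
    kgHw2 (nL κ Φ t p D g f) (ℓL κ Φ t p D g f) (hL κ Φ t p D g f) (vL κ Φ t p D g f) (kgR κ Φ t p D mk) 0 (kgq κ Φ t p D g f (qxQ κ Φ t p D g f))
        (kgW κ Φ t p D g f (WxQ κ Φ t p D g f)) (kgNv0 κ Φ t p D g f mk (qxQ κ Φ t p D g f) (WxQ κ Φ t p D g f)) + 1 ≤
      4 * kgSL (nL κ Φ t p D g f) (ℓL κ Φ t p D g f) (hL κ Φ t p D g f) := by
  have H := kgRows0_of κ Φ t p D g f mk (qxQ κ Φ t p D g f) (WxQ κ Φ t p D g f) hN hg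
  set N := kgNv0 κ Φ t p D g f mk (qxQ κ Φ t p D g f) (WxQ κ Φ t p D g f) with hNdef
  obtain ⟨-, -, hElt⟩ := H.kgE₁_spec N
  have hb := m₂Q_le κ Φ t p D g f mk hN hg hg2
  obtain ⟨-, hs40, hbig, hR1, hK, -⟩ := valsQ_floor κ Φ t p D g f mk hN hg hg2
  have hPd := Skelφ.natDiv_le_kgSLY (one_le_of_eqNumL κ Φ t p D g f hN).1 (ℓL κ Φ t p D g f) (hL κ Φ t p D g f)
  rw [kgSLY_eq_kgSL] at hPd
  unfold kgR at hElt hb ⊢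
  rw [← hNdef] at hb
  set s := kgSL (nL κ Φ t p D g f) (ℓL κ Φ t p D g f) (hL κ Φ t p D g f) with hsdef
  set R := ((KS0.R'0 κ Φ t p D mk : ℕ) : ℤ) with hRdef
  set b := (((kgM₂ (nL κ Φ t p D g f) (ℓL κ Φ t p D g f) (hL κ Φ t p D g f) (vL κ Φ t p D g f) (KS0.R'0 κ Φ t p D mk) 0
      (kgq κ Φ t p D g f (qxQ κ Φ t p D g f)) (kgW κ Φ t p D g f (WxQ κ Φ t p D g f)) N : ℕ) : ℤ)) + 1 with hbdef
  have hb0 : 0 ≤ b := by positivity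
  have hK40R : 1600 * R ≤ s + 1 := by
    have h1 : 40 * (40 : ℤ) * R ≤ 40 * (Neg.K κ : ℤ) * R := by
      have := mul_le_mul_of_nonneg_right hK (show (0 : ℤ) ≤ R by linarith)
      linarith
    linarith
  have hbR : 2 * (b * (R + ((0 : ℕ) : ℤ))) ≤ 426 * R := by push_cast; nlinarith
  unfold kgHw2
  unfold kgP kgDec₁ at hElt
  push_cast at hElt hPd ⊢
  rw [← hbdef]
  nlinarith

/-- **THE FINE-1 READINGS OF THE ARRIVAL BOX**: `−18·s₁ ≤ rdLo₁`, `rdHi₁ ≤ 19·s₁ + 1`, `0 ≤ rdLo₁ + rdHi₁`, `rdHi₁ − rdLo₁ ≤ 4·s₁ + 1`, `rdLo₁ ≤ rdHi₁`.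
[this work] -/
theorem rd1_bounds_Q (κ : Consts) {V : Type} [DecidableEq V] [Countable V] {G : SimpleGraph V} [G.LocallyFinite] (Φ : PlanarSkeletonFrmFrom G) (t : V) (p : unitInterval) (D : Skelφ.StepI.DataNS V) (g : ℕ) (f : ℕ) (mk : ℕ) (hN : EqNumL κ Φ t p D g f) (hg : gFloorKG κ Φ t p D mk ≤ g) (hg2 : 40 * Neg.K κ * KS0.R'0 κ Φ t p D mk ≤ g) :
    -(18 * (((fcellsA κ Φ t p D g f).s 1 : ℕ) : ℤ)) ≤
        rdLo (Aof κ) (nL κ Φ t p D g f) (hL κ Φ t p D g f) (vL κ Φ t p D g f) (vβL κ Φ t p D g f) (prFA κ Φ t p D g f).c₀ (prFA κ Φ t p D g f).c₁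
          (prFA κ Φ t p D g f).D (arrLoQ κ Φ t p D g f mk) (arrHiQ κ Φ t p D g f mk) 1 ∧
      rdHi (Aof κ) (nL κ Φ t p D g f) (hL κ Φ t p D g f) (vL κ Φ t p D g f) (vβL κ Φ t p D g f) (prFA κ Φ t p D g f).c₀ (prFA κ Φ t p D g f).c₁
          (prFA κ Φ t p D g f).D (arrLoQ κ Φ t p D g f mk) (arrHiQ κ Φ t p D g f mk) 1 ≤ 19 * (((fcellsA κ Φ t p D g f).s 1 : ℕ) : ℤ) + 1 ∧
      0 ≤ rdLo (Aof κ) (nL κ Φ t p D g f) (hL κ Φ t p D g f) (vL κ Φ t p D g f) (vβL κ Φ t p D g f) (prFA κ Φ t p D g f).c₀ (prFA κ Φ t p D g f).c₁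
          (prFA κ Φ t p D g f).D (arrLoQ κ Φ t p D g f mk) (arrHiQ κ Φ t p D g f mk) 1 +
        rdHi (Aof κ) (nL κ Φ t p D g f) (hL κ Φ t p D g f) (vL κ Φ t p D g f) (vβL κ Φ t p D g f) (prFA κ Φ t p D g f).c₀ (prFA κ Φ t p D g f).c₁
          (prFA κ Φ t p D g f).D (arrLoQ κ Φ t p D g f mk) (arrHiQ κ Φ t p D g f mk) 1 ∧
      rdHi (Aof κ) (nL κ Φ t p D g f) (hL κ Φ t p D g f) (vL κ Φ t p D g f) (vβL κ Φ t p D g f) (prFA κ Φ t p D g f).c₀ (prFA κ Φ t p D g f).c₁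
          (prFA κ Φ t p D g f).D (arrLoQ κ Φ t p D g f mk) (arrHiQ κ Φ t p D g f mk) 1 -
        rdLo (Aof κ) (nL κ Φ t p D g f) (hL κ Φ t p D g f) (vL κ Φ t p D g f) (vβL κ Φ t p D g f) (prFA κ Φ t p D g f).c₀ (prFA κ Φ t p D g f).c₁
          (prFA κ Φ t p D g f).D (arrLoQ κ Φ t p D g f mk) (arrHiQ κ Φ t p D g f mk) 1 ≤ 4 * (((fcellsA κ Φ t p D g f).s 1 : ℕ) : ℤ) + 1 ∧
      rdLo (Aof κ) (nL κ Φ t p D g f) (hL κ Φ t p D g f) (vL κ Φ t p D g f) (vβL κ Φ t p D g f) (prFA κ Φ t p D g f).c₀ (prFA κ Φ t p D g f).c₁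
          (prFA κ Φ t p D g f).D (arrLoQ κ Φ t p D g f mk) (arrHiQ κ Φ t p D g f mk) 1 ≤
        rdHi (Aof κ) (nL κ Φ t p D g f) (hL κ Φ t p D g f) (vL κ Φ t p D g f) (vβL κ Φ t p D g f) (prFA κ Φ t p D g f).c₀ (prFA κ Φ t p D g f).c₁
          (prFA κ Φ t p D g f).D (arrLoQ κ Φ t p D g f mk) (arrHiQ κ Φ t p D g f mk) 1 := by
  obtain ⟨-, hsc1, -, -, hDp, hm, -, -, hkq, -⟩ := hsc_Q κ Φ t p D g f hN
  obtain ⟨hl1, hh1, -, -⟩ := arr_bounds κ Φ t p D g f mk hN hg hg2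
  obtain ⟨-, -, hbig, -, -, -⟩ := valsQ_floor κ Φ t p D g f mk hN hg hg2
  obtain ⟨hsum, hC0, hdiff, hlohi⟩ := arr1_sum_eq κ Φ t p D g f mk hN hg
  have hHw := kgHw2Q_le κ Φ t p D g f mk hN hg hg2
  have hUs := UsL_le_modulus κ Φ t p D g f hN
  have hr1 : (((fcellsA κ Φ t p D g f).r 1 : ℕ) : ℤ) = 40 * ((Neg.Kq κ : ℕ) : ℤ) * (((fcellsA κ Φ t p D g f).s 1 : ℕ) : ℤ) := by
    rw [PCells2.r_eq, show ((fcellsA κ Φ t p D g f).K : ℤ) = Neg.K κ by exact_mod_cast (fcellsA_K κ Φ t p D g f).1,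
      show (Neg.K κ : ℤ) = 40 * ((Neg.Kq κ : ℕ) : ℤ) by exact_mod_cast Neg.K_eq κ]
  have hkq' : (0 : ℤ) < ((Neg.Kq κ : ℕ) : ℤ) := by exact_mod_cast hkq
  have hsc1' : (prFA κ Φ t p D g f).c₁ * Aof κ * (40 * ((Neg.Kq κ : ℕ) : ℤ) * modulus (nL κ Φ t p D g f) (hL κ Φ t p D g f) (vL κ Φ t p D g f) (vβL κ Φ t p D g f)) =
      40 * ((Neg.Kq κ : ℕ) : ℤ) * (((fcellsA κ Φ t p D g f).s 1 : ℕ) : ℤ) * (prFA κ Φ t p D g f).D := by rw [hsc1, hr1]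
  rw [Skelφ.rdLo_one, Skelφ.rdHi_one, rd1_div_eq (X := _) hDp hkq' hm hsc1', rd1_div_eq (X := _) hDp hkq' hm hsc1']
  -- abbreviate; from here on only integer arithmetic
  generalize hΔ : modulus (nL κ Φ t p D g f) (hL κ Φ t p D g f) (vL κ Φ t p D g f) (vβL κ Φ t p D g f) = Δ at hm hUs
  generalize hUdef : ((shearUnit (nL κ Φ t p D g f) (hL κ Φ t p D g f) : ℕ) : ℤ) = U at hUs
  generalize hsdef : kgSL (nL κ Φ t p D g f) (ℓL κ Φ t p D g f) (hL κ Φ t p D g f) = s at hbig hl1 hh1 hHw hUs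
  generalize hs1def : (((fcellsA κ Φ t p D g f).s 1 : ℕ) : ℤ) = s1
  generalize hlo : arrLoQ κ Φ t p D g f mk 1 = lo at hl1 hsum hdiff hlohi
  generalize hhi : arrHiQ κ Φ t p D g f mk 1 = hi at hh1 hsum hdiff hlohi
  generalize hC : kgCtr2 (nL κ Φ t p D g f) (ℓL κ Φ t p D g f) (hL κ Φ t p D g f) (kgR κ Φ t p D mk) 0 (kgW κ Φ t p D g f (WxQ κ Φ t p D g f))
    (kgNv0 κ Φ t p D g f mk (qxQ κ Φ t p D g f) (WxQ κ Φ t p D g f)) = C at hsum hC0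
  generalize hHwdef : kgHw2 (nL κ Φ t p D g f) (ℓL κ Φ t p D g f) (hL κ Φ t p D g f) (vL κ Φ t p D g f) (kgR κ Φ t p D mk) 0 (kgq κ Φ t p D g f (qxQ κ Φ t p D g f))
    (kgW κ Φ t p D g f (WxQ κ Φ t p D g f)) (kgNv0 κ Φ t p D g f mk (qxQ κ Φ t p D g f) (WxQ κ Φ t p D g f)) = Hw at hdiff hHw
  have hs1p : (1 : ℤ) ≤ s1 := by rw [← hs1def]; exact_mod_cast (fcellsA κ Φ t p D g f).hs 1
  have hU1 : (1 : ℤ) ≤ U := by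
    have := Skelφ.shearUnit_pos (one_le_of_eqNumL κ Φ t p D g f hN).1 (hL κ Φ t p D g f); rw [← hUdef]; exact this
  have hΔ0 : 0 < Δ := hm
  have hU0 : (0 : ℤ) ≤ U := by linarith
  have hs10 : (0 : ℤ) ≤ s1 := by linarith
  have hUUs : U ≤ U * s := by
    have := mul_le_mul_of_nonneg_left (show (1 : ℤ) ≤ s by linarith) hU0; linarith
  have hP1 : (0 : ℤ) ≤ s1 * (U * s) := by positivity
  have hP2 : s1 * (U * s) ≤ s1 * Δ := mul_le_mul_of_nonneg_left hUs hs10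
  -- the two numerators `x := s1·U·lo`, `y := s1·(U·hi + U − 1)`
  have hx_lo : -(18 * s1) * Δ ≤ s1 * (U * lo) := by
    have h1 : U * (-(18 * s)) ≤ U * lo := mul_le_mul_of_nonneg_left (by linarith [(abs_le.1 hl1).1]) hU0
    have h2 : s1 * (U * (-(18 * s))) ≤ s1 * (U * lo) := mul_le_mul_of_nonneg_left h1 hs10
    have e : s1 * (U * (-(18 * s))) = -18 * (s1 * (U * s)) := by ring
    have e2 : -(18 * s1) * Δ = -18 * (s1 * Δ) := by ring
    linarith
  have hy_hi : s1 * (U * hi + U - 1) ≤ 19 * s1 * Δ := by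
    have h1 : U * hi ≤ U * (18 * s) := mul_le_mul_of_nonneg_left (abs_le.1 hh1).2 hU0
    have h2 : U * hi + U - 1 ≤ 19 * (U * s) := by linarith
    have h3 : s1 * (U * hi + U - 1) ≤ s1 * (19 * (U * s)) := mul_le_mul_of_nonneg_left h2 hs10
    have e : s1 * (19 * (U * s)) = 19 * (s1 * (U * s)) := by ring
    have e2 : 19 * s1 * Δ = 19 * (s1 * Δ) := by ring
    linarith
  have hxy_sum : 0 ≤ s1 * (U * lo) + s1 * (U * hi + U - 1) := by
    have e : s1 * (U * lo) + s1 * (U * hi + U - 1) = s1 * (U * (lo + hi) + U - 1) := by ring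
    rw [e, hsum]
    have hUC : 0 ≤ U * C := mul_nonneg hU0 hC0
    exact mul_nonneg hs10 (by linarith)
  have hyx_diff : s1 * (U * hi + U - 1) - s1 * (U * lo) ≤ 4 * s1 * Δ - s1 := by
    have e : s1 * (U * hi + U - 1) - s1 * (U * lo) = s1 * (U * (hi - lo) + U - 1) := by ring
    rw [e]
    have h1 : U * (hi - lo) ≤ U * Hw := mul_le_mul_of_nonneg_left hdiff hU0
    have h2 : U * (Hw + 1) ≤ U * (4 * s) := mul_le_mul_of_nonneg_left hHw hU0
    have h3 : U * (hi - lo) + U - 1 ≤ 4 * (U * s) - 1 := by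
      have e1 : U * (Hw + 1) = U * Hw + U := by ring
      have e2 : U * (4 * s) = 4 * (U * s) := by ring
      linarith
    have h4 : s1 * (U * (hi - lo) + U - 1) ≤ s1 * (4 * (U * s) - 1) := mul_le_mul_of_nonneg_left h3 hs10
    have e3 : s1 * (4 * (U * s) - 1) = 4 * (s1 * (U * s)) - s1 := by ring
    have e4 : 4 * s1 * Δ = 4 * (s1 * Δ) := by ring
    linarith
  have hxy_le : s1 * (U * lo) ≤ s1 * (U * hi + U - 1) := by
    have h1 : U * lo ≤ U * hi := mul_le_mul_of_nonneg_left hlohi hU0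
    exact mul_le_mul_of_nonneg_left (by linarith) hs10
  -- floor arithmetic in `x := s1·U·lo`, `y := s1·(U·hi + U − 1)`
  generalize hx : s1 * (U * lo) = x at hx_lo hxy_sum hyx_diff hxy_le
  generalize hy : s1 * (U * hi + U - 1) = y at hy_hi hxy_sum hyx_diff hxy_le
  have fx1 := Int.lt_mul_ediv_self_add (x := x) hΔ0
  have fx2 := Int.ediv_mul_le x (ne_of_gt hΔ0)
  have fy1 := Int.lt_mul_ediv_self_add (x := y) hΔ0
  have fy2 := Int.ediv_mul_le y (ne_of_gt hΔ0)
  refine ⟨?_, ?_, ?_, ?_, ?_⟩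
  · rw [Int.le_ediv_iff_mul_le hΔ0]; linarith
  · have : y / Δ < 19 * s1 + 1 := by
      rw [Int.ediv_lt_iff_lt_mul hΔ0]
      have e : (19 * s1 + 1) * Δ = 19 * s1 * Δ + Δ := by ring
      linarith
    linarith
  · have h1 : x + y - 2 * Δ < Δ * (x / Δ + y / Δ) := by
      have e : Δ * (x / Δ + y / Δ) = Δ * (x / Δ) + Δ * (y / Δ) := by ring
      linarith
    have h2 : -2 < x / Δ + y / Δ := by
      by_contra hcon
      push Not at hcon
      have : Δ * (x / Δ + y / Δ) ≤ Δ * (-2) := mul_le_mul_of_nonneg_left hcon hΔ0.le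
      linarith
    linarith
  · have h1 : Δ * (y / Δ - x / Δ) < y - x + Δ := by
      have e : Δ * (y / Δ - x / Δ) = y / Δ * Δ - Δ * (x / Δ) := by ring
      linarith
    have h2 : y / Δ - x / Δ < 4 * s1 + 1 := by
      by_contra hcon
      push Not at hcon
      have h3 : Δ * (4 * s1 + 1) ≤ Δ * (y / Δ - x / Δ) := mul_le_mul_of_nonneg_left hcon hΔ0.le
      have e : Δ * (4 * s1 + 1) = 4 * s1 * Δ + Δ := by ring
      linarith
    linarith
  · have := Int.ediv_le_ediv hΔ0 hxy_le
    linarith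

/-- `cRv 0` as an integer is the midpoint (the `toNat` is inactive). [folklore] -/
theorem cRv_zero_eq (κ : Consts) {V : Type} [DecidableEq V] [Countable V] {G : SimpleGraph V} [G.LocallyFinite] (Φ : PlanarSkeletonFrmFrom G) (t : V) (p : unitInterval) (D : Skelφ.StepI.DataNS V) (g : ℕ) (f : ℕ) (mk : ℕ) (hN : EqNumL κ Φ t p D g f) (hg : gFloorKG κ Φ t p D mk ≤ g) (hg2 : 40 * Neg.K κ * KS0.R'0 κ Φ t p D mk ≤ g) :
    ((cRv κ Φ t p D g f mk 0 : ℕ) : ℤ) = cmid κ Φ t p D g f mk ∧ 0 ≤ cmid κ Φ t p D g f mk := by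
  obtain ⟨-, -, hs, -, -⟩ := rd1_bounds_Q κ Φ t p D g f mk hN hg hg2
  have h0 : 0 ≤ cmid κ Φ t p D g f mk := by unfold cmid; omega
  exact ⟨by rw [cRv_zero, Int.toNat_of_nonneg h0], h0⟩

/-- **THE PER-AXIS CAP HOLDS FOR THE CREEP OF RECORD**: `cRv i ≤ r (oth i)` (`cRv 0 ≤ 19·s₁ + 1 ≤ K·s₁ = r 1`, `cRv 1 = 0`) — so `(fcellsT … (cRv …)).c i = cRv i`
(`fcellsT_c_eq`, SkelFrmBChoiceDefsT). [this work] -/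
theorem cRv_le_r_oth (κ : Consts) {V : Type} [DecidableEq V] [Countable V] {G : SimpleGraph V} [G.LocallyFinite] (Φ : PlanarSkeletonFrmFrom G) (t : V) (p : unitInterval) (D : Skelφ.StepI.DataNS V) (g : ℕ) (f : ℕ) (mk : ℕ) (hN : EqNumL κ Φ t p D g f) (hg : gFloorKG κ Φ t p D mk ≤ g) (hg2 : 40 * Neg.K κ * KS0.R'0 κ Φ t p D mk ≤ g) :
    ∀ i, cRv κ Φ t p D g f mk i ≤ (fcellsA κ Φ t p D g f).r (oth i) := by
  intro i
  fin_cases i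
  · obtain ⟨hlo, hhi, hs, -, hle⟩ := rd1_bounds_Q κ Φ t p D g f mk hN hg hg2
    obtain ⟨hc, -⟩ := cRv_zero_eq κ Φ t p D g f mk hN hg hg2
    have e : oth (0 : Fin 2) = 1 := by decide
    have hr1 : (((fcellsA κ Φ t p D g f).r 1 : ℕ) : ℤ) = (Neg.K κ : ℤ) * (((fcellsA κ Φ t p D g f).s 1 : ℕ) : ℤ) := by
      rw [PCells2.r_eq, show ((fcellsA κ Φ t p D g f).K : ℤ) = Neg.K κ by exact_mod_cast (fcellsA_K κ Φ t p D g f).1]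
    have hK : (40 : ℤ) ≤ Neg.K κ := by exact_mod_cast (Neg.forty_le_K κ).1
    have hs1p : (1 : ℤ) ≤ (((fcellsA κ Φ t p D g f).s 1 : ℕ) : ℤ) := by exact_mod_cast (fcellsA κ Φ t p D g f).hs 1
    have hKs : 40 * (((fcellsA κ Φ t p D g f).s 1 : ℕ) : ℤ) ≤ (Neg.K κ : ℤ) * (((fcellsA κ Φ t p D g f).s 1 : ℕ) : ℤ) :=
      mul_le_mul_of_nonneg_right hK (by linarith)
    have key : ((cRv κ Φ t p D g f mk 0 : ℕ) : ℤ) ≤ (((fcellsA κ Φ t p D g f).r 1 : ℕ) : ℤ) := by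
      rw [hc, hr1]; unfold cmid
      generalize rdLo (Aof κ) (nL κ Φ t p D g f) (hL κ Φ t p D g f) (vL κ Φ t p D g f) (vβL κ Φ t p D g f) (prFA κ Φ t p D g f).c₀ (prFA κ Φ t p D g f).c₁
          (prFA κ Φ t p D g f).D (arrLoQ κ Φ t p D g f mk) (arrHiQ κ Φ t p D g f mk) 1 = lo at hlo hhi hs hle
      generalize rdHi (Aof κ) (nL κ Φ t p D g f) (hL κ Φ t p D g f) (vL κ Φ t p D g f) (vβL κ Φ t p D g f) (prFA κ Φ t p D g f).c₀ (prFA κ Φ t p D g f).c₁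
          (prFA κ Φ t p D g f).D (arrLoQ κ Φ t p D g f mk) (arrHiQ κ Φ t p D g f mk) 1 = hi at hlo hhi hs hle
      generalize (((fcellsA κ Φ t p D g f).s 1 : ℕ) : ℤ) = s1 at hlo hhi hs1p hKs
      omega
    show cRv κ Φ t p D g f mk 0 ≤ (fcellsA κ Φ t p D g f).r (oth 0)
    rw [e]; exact_mod_cast key
  · show cRv κ Φ t p D g f mk 1 ≤ _
    rw [cRv_one]; exact Nat.zero_le _

/-- **THE ARRIVAL READING ROW, ACROSS (`hLt` at `du.1 = 0`)**: `cRv 0 − b₁ + 1 ≤ rdLo₁ ∧ rdHi₁ ≤ cRv 0 + b₁ − 1 ∧ −2r₁ ≤ rdLo₁ ∧ rdHi₁ ≤ 2r₁` for the arrival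
box `[arrLoQ, arrHiQ]`, the creep of record `cRv 0` and the window of record `b₁ = small 1 = 8·s₁`. [this work] -/
theorem hLt_Q (κ : Consts) {V : Type} [DecidableEq V] [Countable V] {G : SimpleGraph V} [G.LocallyFinite] (Φ : PlanarSkeletonFrmFrom G) (t : V) (p : unitInterval) (D : Skelφ.StepI.DataNS V) (g : ℕ) (f : ℕ) (mk : ℕ) (hN : EqNumL κ Φ t p D g f) (hg : gFloorKG κ Φ t p D mk ≤ g) (hg2 : 40 * Neg.K κ * KS0.R'0 κ Φ t p D mk ≤ g) :
    ((cRv κ Φ t p D g f mk 0 : ℕ) : ℤ) - ((BSlot.small κ Φ t p D g f 1 : ℕ) : ℤ) + 1 ≤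
        rdLo (Aof κ) (nL κ Φ t p D g f) (hL κ Φ t p D g f) (vL κ Φ t p D g f) (vβL κ Φ t p D g f) (prFA κ Φ t p D g f).c₀ (prFA κ Φ t p D g f).c₁
          (prFA κ Φ t p D g f).D (arrLoQ κ Φ t p D g f mk) (arrHiQ κ Φ t p D g f mk) 1 ∧
      rdHi (Aof κ) (nL κ Φ t p D g f) (hL κ Φ t p D g f) (vL κ Φ t p D g f) (vβL κ Φ t p D g f) (prFA κ Φ t p D g f).c₀ (prFA κ Φ t p D g f).c₁
          (prFA κ Φ t p D g f).D (arrLoQ κ Φ t p D g f mk) (arrHiQ κ Φ t p D g f mk) 1 ≤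
        ((cRv κ Φ t p D g f mk 0 : ℕ) : ℤ) + ((BSlot.small κ Φ t p D g f 1 : ℕ) : ℤ) - 1 ∧
      -(2 * (((fcellsA κ Φ t p D g f).r 1 : ℕ) : ℤ)) ≤
        rdLo (Aof κ) (nL κ Φ t p D g f) (hL κ Φ t p D g f) (vL κ Φ t p D g f) (vβL κ Φ t p D g f) (prFA κ Φ t p D g f).c₀ (prFA κ Φ t p D g f).c₁
          (prFA κ Φ t p D g f).D (arrLoQ κ Φ t p D g f mk) (arrHiQ κ Φ t p D g f mk) 1 ∧
      rdHi (Aof κ) (nL κ Φ t p D g f) (hL κ Φ t p D g f) (vL κ Φ t p D g f) (vβL κ Φ t p D g f) (prFA κ Φ t p D g f).c₀ (prFA κ Φ t p D g f).c₁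
          (prFA κ Φ t p D g f).D (arrLoQ κ Φ t p D g f mk) (arrHiQ κ Φ t p D g f mk) 1 ≤ 2 * (((fcellsA κ Φ t p D g f).r 1 : ℕ) : ℤ) := by
  obtain ⟨hlo, hhi, hs, hw, hle⟩ := rd1_bounds_Q κ Φ t p D g f mk hN hg hg2
  obtain ⟨hc, -⟩ := cRv_zero_eq κ Φ t p D g f mk hN hg hg2
  have hr1 : (((fcellsA κ Φ t p D g f).r 1 : ℕ) : ℤ) = (Neg.K κ : ℤ) * (((fcellsA κ Φ t p D g f).s 1 : ℕ) : ℤ) := by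
    rw [PCells2.r_eq, show ((fcellsA κ Φ t p D g f).K : ℤ) = Neg.K κ by exact_mod_cast (fcellsA_K κ Φ t p D g f).1]
  have hb1 : ((BSlot.small κ Φ t p D g f 1 : ℕ) : ℤ) = 8 * (((fcellsA κ Φ t p D g f).s 1 : ℕ) : ℤ) := by rw [(small_eq κ Φ t p D g f).2]; push_cast; ring
  have hK : (40 : ℤ) ≤ Neg.K κ := by exact_mod_cast (Neg.forty_le_K κ).1
  have hs1p : (1 : ℤ) ≤ (((fcellsA κ Φ t p D g f).s 1 : ℕ) : ℤ) := by exact_mod_cast (fcellsA κ Φ t p D g f).hs 1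
  have hKs : 40 * (((fcellsA κ Φ t p D g f).s 1 : ℕ) : ℤ) ≤ (Neg.K κ : ℤ) * (((fcellsA κ Φ t p D g f).s 1 : ℕ) : ℤ) :=
    mul_le_mul_of_nonneg_right hK (by linarith)
  rw [hc, hr1, hb1]
  unfold cmid
  generalize rdLo (Aof κ) (nL κ Φ t p D g f) (hL κ Φ t p D g f) (vL κ Φ t p D g f) (vβL κ Φ t p D g f) (prFA κ Φ t p D g f).c₀ (prFA κ Φ t p D g f).c₁
      (prFA κ Φ t p D g f).D (arrLoQ κ Φ t p D g f mk) (arrHiQ κ Φ t p D g f mk) 1 = lo at hlo hhi hs hw hle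
  generalize rdHi (Aof κ) (nL κ Φ t p D g f) (hL κ Φ t p D g f) (vL κ Φ t p D g f) (vβL κ Φ t p D g f) (prFA κ Φ t p D g f).c₀ (prFA κ Φ t p D g f).c₁
      (prFA κ Φ t p D g f).D (arrLoQ κ Φ t p D g f mk) (arrHiQ κ Φ t p D g f mk) 1 = hi at hlo hhi hs hw hle
  generalize (Neg.K κ : ℤ) * (((fcellsA κ Φ t p D g f).s 1 : ℕ) : ℤ) = Ks at hKs
  generalize (((fcellsA κ Φ t p D g f).s 1 : ℕ) : ℤ) = s1 at hlo hhi hw hs1p hKs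
  omega

end Creep

/-- **THE CREEP SLOT OF RECORD** `cR mk : CSlot` (= `cRv` at the merged record and the box/width values; kit index `mk`, `0` at the node). [this work] -/
def cR (mk : ℕ) : CSlot := fun κ _ _ _ _ _ Φ t p D g f => cRv κ Φ t p D g f mk

/-- `cR` by name. [folklore] -/
theorem cR_apply (mk : ℕ) (κ : Consts) {V : Type} [DecidableEq V] [Countable V] {G : SimpleGraph V} [G.LocallyFinite] (Φ : PlanarSkeletonFrmFrom G) (t : V)
    (p : unitInterval) (D : Skelφ.StepI.DataNS V) (g f : ℕ) : cR mk κ Φ t p D g f = cRv κ Φ t p D g f mk := rfl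

end NegB

end PlanarSkeletonFrmFrom

end Summit.CriticalPhenomena.PercolationContinuityZ3.Theorems.Transplant

end
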